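import Summits.BirchSwinnertonDyer.BirchSwinnertonDyer.Theorems.ByReductionTypeAtTwoOrdKatoHalfAtTwoIsoKerCyclotomicTransposition
import Summits.BirchSwinnertonDyer.BirchSwinnertonDyer.Theorems.SmallImageMuTransferMuTransferX9StepTwoElementKernels
import Summits.BirchSwinnertonDyer.BirchSwinnertonDyer.Theorems.SmallImageMuTransferMuTransferX9StepOneResidue
import Literature.NumberTheory.GaloisRepresentations.ChebotarevOpenSubgroup
import Literature.NumberTheory.EllipticCurves.NonEisensteinPrimeOfSurjective
import HarnessLib

/-!
# Route ByReductionTypeAtTwo, crux `OrdKatoHalfAtTwoIso` (stmt-BirchSwinnertonDyer-19573), child B8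
# `OrdKatoIntSurjectiveAtTwo` (stmt-BirchSwinnertonDyer-23762): the transposition prime (H-C) of socket 1 WITHOUT the
# hypothesis `Δ < 0` — on the whole habitat of B8 (`0 < Δ` included) for the cyclotomic tower

Seat `cruxlead-stmt-BirchSwinnertonDyer-19573-w2` (prover WIDTH under the LEAD cruxlead-19573 g4, line
`steinberg-fibre-at-two`; HOME `run/shared/lean/pub/bsd-2adic/`; `--supports` stmt-BirchSwinnertonDyer-23762). HONEST FRAMING
(cell bsd-2adic): BSD is not proved by any of this; neither the crux nor the child B8 is proved here; theorems only (no
definition, no named fact, no `sorry`).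

WHAT. The registered stub Ω1 of the line, (H-C) `ChebotarevTranspositionTwo` (`…OmegaRoadDefs` §2; PROVED on its stated
habitat `ρ̄_{E,2}` onto ∧ `Δ < 0` by p662346 `…ChebotarevTranspositionTwo`), uses `Δ < 0` only to have complex conjugation
as a transposition of `E[2]` inside `ker κ`. With the sign-free supply of such a transposition for the CYCLOTOMIC tower
(`exists_mem_kerSubgroup_sign_permGal_eq_neg_one_of_isCyclotomic`, previous file of this seat: `κ` cyclotomic,
`2Δ ∉ ℚ^{×2}` — automatic at a good `2`), the whole (H-C) argument runs verbatim for EITHER sign of `Δ`: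

* §1 the bottom cocycles `(φ)₀`, `(ψ)₀` of `E[2]` do not vanish on `ker ρ̄₂ ⊓ ker κ` (Steinberg–Sah, sign-free forms);
* §2 `exists_isArithFrobAt_transposition_weilPairingHom_ne_zero_of_mem_kerSubgroup` — (H-C) on the bottom cocycles from ANY
  transposition `τ ∈ ker κ` (the p662346 proof with `c ↦ τ`; `τ² = 1` is needed only on `E[2]`), and its cyclotomic /
  good-at-`2` forms;
* §3 `chebotarevTransposition_two_of_isCyclotomic` — the statement of `ChebotarevTranspositionTwo` with `W.Δ < 0`
  REPLACED by `¬ IsSquare (2 * W.Δ)` (the `κ.IsCyclotomic` binder, idle in p662346, is now used), and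
  `chebotarevTransposition_two_of_good_two` — the same with `W.HasGoodReductionAtPrime 2` instead.

Consequence for B8 (recorded, nothing asserted): of the three inputs of socket 1 (`stub_port_of_rankOne`: T1 sign-free and
PROVED, Ω1, Ω2), only Ω2 = (H-K) `KolyvaginRankOneTwo` still carries `Δ < 0` (the real place: `H¹(ℝ, 𝒯_J) = 0` iff
`Δ < 0`; p662576 `StepFour…`) — the exact kernel locus of MEMO-6's archimedean factor `c_∞ = 2` on B8's `0 < Δ` half.

References: B. Mazur, K. Rubin, Mem. AMS 799 (2004) §3.6, Prop. 1.3.2 [MazurRubin2004]; J. Tate, in Cassels–Fröhlich (1967)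
VII §2.4 [TateGCFT1967]; C.-H. Sah, J. Algebra 10 (1968) Prop. 2.7 (b) [Sah1968]; L. C. Washington (1997) §13.1
[Washington1997]; the line's files p661914 (`…HCEngine`), p662346 (`…ChebotarevTranspositionTwo`), p657595, p658151.
-/

set_option autoImplicit false
set_option linter.dupNamespace false

noncomputable section

open scoped NumberField
open Field WeierstrassCurve Function IsDedekindDomain NumberField
open Literature.NumberTheory.EllipticCurves Literature.NumberTheory.GaloisRepresentations
open Literature.NumberTheory.EllipticCurves.DokchitserDokchitser2012
open Summit.BirchSwinnertonDyer.BirchSwinnertonDyer.Rank1Residual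

-- D-0017: single-problem summit, so `Summit.BirchSwinnertonDyer.BirchSwinnertonDyer.…` repeats a namespace BY DESIGN.
namespace Summit.BirchSwinnertonDyer.BirchSwinnertonDyer.Theorems.SteinbergFibreAtTwo

/-- A transposition of three letters is an involution. [folklore] -/
private theorem perm_fin_three_mul_self_of_sign_eq_neg_one :
    ∀ g : Equiv.Perm (Fin 3), Equiv.Perm.sign g = -1 → g * g = 1 := by
  decide

/-! ## §1 The bottom cocycles of `E[2]` do not vanish on `ker ρ̄_{E,2} ⊓ ker κ` (sign-free) -/

section Bottom

variable (W : WeierstrassCurve ℚ) [W.IsElliptic] (κ : ZpExtension ℚ 2)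

/-- **`φ₀ = (φ)₀` does not vanish on `ker ρ̄₂ ⊓ ker κ`** when `φ` represents `κ'_{J+1}` with `κ̄' ≠ 0` — for `κ`
cyclotomic, `ρ̄_{E,2}` onto and `2Δ ∉ ℚ^{×2}` (either sign of `Δ`): the class of the bottom cocycle is `κ̄' ≠ 0`,
while a cocycle of `E[2]` vanishing there has zero class (sign-free Steinberg–Sah). Sign-free form of p662346 §5.
[cite: MazurRubin2004, §5.3] [cite: Sah1968, Prop. 2.7 (b)] -/
theorem exists_mem_constCoeff_apply_ne_zero_of_towerConst_ne_zero_of_isCyclotomic (hκ : κ.IsCyclotomic)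
    (h2 : W.HasSurjectiveModNGaloisRep 2) (hΔ : ¬ IsSquare (2 * W.Δ))
    (κ' : κ.twistTower (W.torsionGaloisModule (2 : ℤ))
      (fun P : geomTorsion W (2 : ℤ) => AddSubgroup.torsionBy.nsmul P))
    (hκ' : κ.towerConst (W.torsionGaloisModule (2 : ℤ)) (fun P => AddSubgroup.torsionBy.nsmul P) κ' ≠ 0)
    (J : ℕ) (φ : contOneCocycles (W.modPTwist 2 κ (J + 1)).toTopRep)
    (hφ : oneCocycleClass (W.modPTwist 2 κ (J + 1)).toTopRep φ = κ'.1 (J + 1)) :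
    ∃ ν ∈ (galoisRepTorsion W 2).ker ⊓ κ.kerSubgroup,
      (κ.pushCocycle (W.torsionGaloisModule (2 : ℤ))
          (fun P : geomTorsion W (2 : ℤ) => AddSubgroup.torsionBy.nsmul P) (J + 1)
          (κ.twistModPConstCoeff (W.torsionGaloisModule (2 : ℤ))
            (fun P : geomTorsion W (2 : ℤ) => AddSubgroup.torsionBy.nsmul P) (J + 1) (Nat.succ_pos J)) φ).1 ν ≠ 0 := by
  by_contra hcon
  push Not at hcon
  have hc : galoisCohomology.map (κ.twistModPConstCoeff (W.torsionGaloisModule (2 : ℤ))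
      (fun P : geomTorsion W (2 : ℤ) => AddSubgroup.torsionBy.nsmul P) (J + 1) (Nat.succ_pos J)) 1
      (κ'.1 (J + 1)) ≠ 0 := by
    rw [LevelE.map_constCoeff_level_eq_towerConst]
    exact hκ'
  rw [← hφ] at hc
  change galoisCohomology.map _ 1 (oneCocycleClass (κ.twistModP (W.torsionGaloisModule (2 : ℤ))
    (fun P : geomTorsion W (2 : ℤ) => AddSubgroup.torsionBy.nsmul P) (J + 1)).toTopRep φ) ≠ 0 at hc
  rw [ZpExtension.map_oneCocycleClass_twist] at hc
  exact hc (torsion_two_oneCocycleClass_eq_zero_of_forall_mem_eq_zero_of_isCyclotomic W κ hκ h2 hΔ _ hcon)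

/-- **`ψ₀ = (ψ)₀` does not vanish on `ker ρ̄₂ ⊓ ker κ`** when `T^J[ψ] ≠ 0` in `H¹(ℚ, 𝒯_{J+1}(χ⁻¹))` — for `κ`
cyclotomic, `ρ̄_{E,2}` onto and `2Δ ∉ ℚ^{×2}` (either sign of `Δ`). Sign-free form of p662346 §5 (dual-twist
Steinberg–Sah). [cite: MazurRubin2004, §5.3] [cite: Sah1968, Prop. 2.7 (b)] -/
theorem exists_mem_constCoeff_apply_ne_zero_of_shiftH1_iterate_ne_zero_of_isCyclotomic (hκ : κ.IsCyclotomic)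
    (h2 : W.HasSurjectiveModNGaloisRep 2) (hΔ : ¬ IsSquare (2 * W.Δ)) (J : ℕ)
    (ψ : contOneCocycles (W.modPTwist 2 κ.invTwist (J + 1)).toTopRep)
    (hψ : (κ.invTwist.shiftH1 (W.torsionGaloisModule (2 : ℤ))
        (fun P : geomTorsion W (2 : ℤ) => AddSubgroup.torsionBy.nsmul P) (J + 1))^[J]
      (oneCocycleClass (W.modPTwist 2 κ.invTwist (J + 1)).toTopRep ψ) ≠ 0) :
    ∃ ν ∈ (galoisRepTorsion W 2).ker ⊓ κ.kerSubgroup,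
      (κ.invTwist.pushCocycle (W.torsionGaloisModule (2 : ℤ))
          (fun P : geomTorsion W (2 : ℤ) => AddSubgroup.torsionBy.nsmul P) (J + 1)
          (κ.invTwist.twistModPConstCoeff (W.torsionGaloisModule (2 : ℤ))
            (fun P : geomTorsion W (2 : ℤ) => AddSubgroup.torsionBy.nsmul P) (J + 1) (Nat.succ_pos J)) ψ).1 ν ≠ 0 := by
  by_contra hcon
  push Not at hcon
  apply hψ
  change (κ.invTwist.shiftH1 (W.torsionGaloisModule (2 : ℤ))
      (fun P : geomTorsion W (2 : ℤ) => AddSubgroup.torsionBy.nsmul P) (J + 1))^[J]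
    (oneCocycleClass (κ.invTwist.twistModP (W.torsionGaloisModule (2 : ℤ))
      (fun P : geomTorsion W (2 : ℤ) => AddSubgroup.torsionBy.nsmul P) (J + 1)).toTopRep ψ) = 0
  rw [ZpExtension.shiftH1_iterate_oneCocycleClass]
  have key : oneCocycleClass _ (κ.invTwist.shiftPowCocycle (W.torsionGaloisModule (2 : ℤ))
        (fun P : geomTorsion W (2 : ℤ) => AddSubgroup.torsionBy.nsmul P) (J + 1) J ψ) =
      oneCocycleClass _ 0 :=
    invTwist_modPTwist_two_oneCocycleClass_eq_of_forall_mem_eq_of_isCyclotomic W κ hκ h2 hΔ (J + 1) _ 0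
      fun ν hν => by
        rw [ZpExtension.shiftPowCocycle_apply]
        change _ = (0 : Fin (J + 1) → geomTorsion W (2 : ℤ))
        funext i
        rw [shiftEnd_pow_apply, Pi.zero_apply]
        by_cases hi : (i : ℕ) < J
        · rw [dif_pos hi]
        · rw [dif_neg hi]
          have hi2 := i.2
          have hfin : (⟨(i : ℕ) - J, by omega⟩ : Fin (J + 1)) = ⟨0, Nat.succ_pos J⟩ :=
            Fin.ext (show (i : ℕ) - J = 0 by omega)
          rw [hfin]
          exact hcon ν hν
  exact key.trans (oneCocycleClass_zero _)

end Bottom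

/-! ## §2 (H-C) from ANY transposition `τ ∈ ker κ` -/

section Main

variable (W : WeierstrassCurve ℚ) [W.IsElliptic] (κ : ZpExtension ℚ 2)

/-- **(H-C) on the bottom cocycles from a transposition `τ ∈ ker κ`.** For `ρ̄_{E,2}` onto, `τ ∈ ker κ` odd on
`{T₀, T₁, T₂}`, two continuous 1-cocycles `φ₀`, `ψ₀` of `E[2]` that do not vanish on `ker ρ̄₂ ⊓ ker κ`, an alternating
non-degenerate pairing `e` on `E[2]`, a finite set `S` of places and `n : ℕ`: there is `q ∉ S` with a Frobenius `Fr`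
above it which is a transposition on `E[2]`, lies in `Gal(ℚ̄/ℚ_n)`, and has `e((Fr − 1)φ₀(Fr), ψ₀(Fr)) ≠ 1`. Proof =
p662346's, with complex conjugation replaced by `τ` (a `3`-cycle in `ker κ` for the Steinberg–Sah step comes from `τ`
by p657099; `τ² = 1` is used only through its action on `E[2]`).
[cite: MazurRubin2004, §3.6 and Prop. 1.3.2] [cite: TateGCFT1967, §2.4 (Tchebotarev density theorem) with Prop. 2.3] -/
theorem exists_isArithFrobAt_transposition_weilPairingHom_ne_zero_of_mem_kerSubgroup
    (h2 : W.HasSurjectiveModNGaloisRep 2) {τ : absoluteGaloisGroup ℚ} (hτκ : τ ∈ κ.kerSubgroup)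
    (hsign : Equiv.Perm.sign (permGal W (two_ne_zero : (2 : ℚ) ≠ 0) τ) = -1)
    (φ₀ ψ₀ : contOneCocycles (W.torsionGaloisModule (2 : ℤ)).toTopRep)
    (hφ₀ : ∃ ν ∈ (galoisRepTorsion W 2).ker ⊓ κ.kerSubgroup, φ₀.1 ν ≠ 0)
    (hψ₀ : ∃ ν ∈ (galoisRepTorsion W 2).ker ⊓ κ.kerSubgroup, ψ₀.1 ν ≠ 0)
    (eW : geomTorsion W (2 : ℤ) → geomTorsion W (2 : ℤ) → AlgebraicClosure ℚ)
    (hμ : ∀ S T, eW S T ^ 2 = 1)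
    (hadd₁ : ∀ S₁ S₂ T, eW (S₁ + S₂) T = eW S₁ T * eW S₂ T)
    (hadd₂ : ∀ S T₁ T₂, eW S (T₁ + T₂) = eW S T₁ * eW S T₂)
    (halt : ∀ T, eW T T = 1) (hnondeg : ∀ T, (∀ S, eW S T = 1) → T = 0)
    (S : Set (HeightOneSpectrum (𝓞 ℚ))) (hS : S.Finite) (n : ℕ) :
    ∃ q : HeightOneSpectrum (𝓞 ℚ), q ∉ S ∧ ∃ 𝔓 ∈ q.primesAbove, ∃ Fr : absoluteGaloisGroup ℚ,
      IsArithFrobAt (𝓞 ℚ) Fr 𝔓 ∧ galoisRepTorsion W 2 Fr ≠ 1 ∧ galoisRepTorsion W 2 (Fr * Fr) = 1 ∧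
      Fr ∈ κ.layerSubgroup n ∧
      weilPairingHom W 2 eW hμ hadd₁ hadd₂ (Fr • φ₀.1 Fr - φ₀.1 Fr) (ψ₀.1 Fr) ≠ 0 := by
  -- irreducibility of `E[2]` (from surjectivity)
  have hirr : ∀ B : AddSubgroup (geomTorsion W (2 : ℤ)),
      (∀ g : absoluteGaloisGroup ℚ, ∀ x ∈ B, g • x ∈ B) → B = ⊥ ∨ B = ⊤ :=
    hasIrreducibleModPGaloisRep_of_hasSurjectiveModNGaloisRep W 2 h2
  -- `τ` is a transposition in `ker κ`: `τ² = 1` on `E[2]`, a moved point, the fixed line; a 3-cycle in `ker κ`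
  have hττ : ∀ P : geomTorsion W 2, (τ * τ) • P = P :=
    (forall_smul_eq_iff_permGal_eq_one W (τ * τ)).mpr
      (by rw [permGal_mul]; exact perm_fin_three_mul_self_of_sign_eq_neg_one _ hsign)
  have hne1 : permGal W two_ne_zero τ ≠ 1 := by
    intro h
    rw [h, Equiv.Perm.sign_one] at hsign
    exact absurd hsign (by decide)
  obtain ⟨x₀, hx₀⟩ : ∃ P : geomTorsion W 2, τ • P ≠ P := by
    by_contra h
    push Not at h
    exact hne1 ((forall_smul_eq_iff_permGal_eq_one W τ).mp h)
  obtain ⟨P, hP0, hcP, hℓ, -⟩ := exists_fixedPoint_of_sign_permGal_eq_neg_one W hsign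
  have hρc : galoisRepTorsion W 2 τ ≠ 1 := fun h =>
    hx₀ ((mem_ker_galoisRepTorsion_two_iff W τ).mp (MonoidHom.mem_ker.mpr h) x₀)
  obtain ⟨σ₀, hσ₀κ, hσ₀⟩ := exists_mem_kerSubgroup_forall_smul_ne W κ h2 hτκ hsign
  -- `G = ker ρ̄₂ ⊓ Gal(ℚ̄/ℚ_n)`: open, normal, acts trivially on `E[2]`
  set G : Subgroup (absoluteGaloisGroup ℚ) := (galoisRepTorsion W 2).ker ⊓ κ.layerSubgroup n with hG
  haveI hGn : G.Normal := Subgroup.normal_inf_normal _ _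
  have hGV : ∀ σ ∈ G, ∀ x : (W.torsionGaloisModule (2 : ℤ)).toTopRep,
      (W.torsionGaloisModule (2 : ℤ)).toTopRep.ρ σ x = x :=
    fun σ hσ x => (mem_ker_galoisRepTorsion_two_iff W σ).mp (Subgroup.mem_inf.mp hσ).1 x
  have hGo : IsOpen (G : Set (absoluteGaloisGroup ℚ)) :=
    (W.isOpen_ker_galoisRepTorsion_holds (n := (2 : ℤ)) two_ne_zero).inter (κ.isOpen_layerSubgroup n)
  have hNG : (galoisRepTorsion W 2).ker ⊓ κ.kerSubgroup ≤ G :=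
    inf_le_inf_left _ (κ.kerSubgroup_le_layerSubgroup n)
  -- the joint values `A = (φ₀, ψ₀)(G)`
  set A := contOneCocycles.jointValueSubgroup φ₀ ψ₀ G hGV hGV with hA
  have hAst : ∀ g : absoluteGaloisGroup ℚ, ∀ z ∈ A, (g • z.1, g • z.2) ∈ A :=
    fun g z hz => contOneCocycles.smul_mem_jointValueSubgroup φ₀ ψ₀ G hGV hGV g hz
  obtain ⟨ν₁, hν₁, hφν₁⟩ := hφ₀
  obtain ⟨ν₂, hν₂, hψν₂⟩ := hψ₀
  have hA1 : ∃ z ∈ A, z.1 ≠ 0 := ⟨(φ₀.1 ν₁, ψ₀.1 ν₁), ⟨ν₁, hNG hν₁, rfl⟩, hφν₁⟩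
  have hA2 : ∃ z ∈ A, z.2 ≠ 0 := ⟨(φ₀.1 ν₂, ψ₀.1 ν₂), ⟨ν₂, hNG hν₂, rfl⟩, hψν₂⟩
  -- in the diagonal case `φ₀(τ) − ψ₀(τ) ∈ ℓ_τ` (Sah for `φ₀ − ψ₀`)
  have hdiag : (∀ z ∈ A, z.1 = z.2) → τ • (φ₀.1 τ - ψ₀.1 τ) = φ₀.1 τ - ψ₀.1 τ := by
    intro hd
    have h0 : oneCocycleClass _ (φ₀ - ψ₀) = 0 :=
      torsion_two_oneCocycleClass_eq_zero_of_forall_mem_eq_zero_of_noFixedPoint W κ hσ₀κ hσ₀ (φ₀ - ψ₀)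
        fun ν hν => by
          have := hd (φ₀.1 ν, ψ₀.1 ν) ⟨ν, hNG hν, rfl⟩
          change φ₀.1 ν - ψ₀.1 ν = 0
          exact sub_eq_zero.mpr this
    obtain ⟨w, hw⟩ := (oneCocycleClass_eq_zero_iff _ _).mp h0
    have hwc : φ₀.1 τ - ψ₀.1 τ = τ • w - w := hw τ
    rw [hwc, smul_sub, ← mul_smul, hττ w, ← neg_sub (τ • w) w]
    exact neg_eq_self_geomTorsion_two W _
  -- the joint value `(φ₀ a, ψ₀ a)`, `a ∈ G`
  obtain ⟨z, hzA, hz1, hz2⟩ := exists_mem_stableProd_smul_add_ne hirr hP0 hcP hℓ A hAst hA1 hA2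
    (φ₀.1 τ) (ψ₀.1 τ) hdiag hx₀
  obtain ⟨a, haG, rfl⟩ := hzA
  dsimp only at hz1 hz2
  -- `σ := a τ`
  have haρ : a ∈ (galoisRepTorsion W 2).ker := (Subgroup.mem_inf.mp haG).1
  have hσn : a * τ ∈ κ.layerSubgroup n :=
    (κ.layerSubgroup n).mul_mem (Subgroup.mem_inf.mp haG).2 (κ.kerSubgroup_le_layerSubgroup n hτκ)
  have hρσ : galoisRepTorsion W 2 (a * τ) = galoisRepTorsion W 2 τ := by
    rw [map_mul, MonoidHom.mem_ker.mp haρ, one_mul]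
  have hφσ : φ₀.1 (a * τ) = φ₀.1 a + φ₀.1 τ := contOneCocycles.apply_mul_of_fixed φ₀ (hGV a haG) τ
  have hψσ : ψ₀.1 (a * τ) = ψ₀.1 a + ψ₀.1 τ := contOneCocycles.apply_mul_of_fixed ψ₀ (hGV a haG) τ
  have hσx : ∀ x : geomTorsion W (2 : ℤ), (a * τ) • x = τ • x := fun x => by
    rw [mul_smul, (mem_ker_galoisRepTorsion_two_iff W a).mp haρ]
  -- the open normal subgroup `N = {g ∈ G : φ₀ g = ψ₀ g = 0}`
  obtain ⟨N, hNn, hNo, hNK, hNL, hNφ, hNψ⟩ :=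
    JointValue.exists_normal_isOpen_le_forall_apply_eq_zero φ₀ ψ₀ G hGV hGV hGo (κ.layerSubgroup n)
      (κ.isOpen_layerSubgroup n) (isOpen_discrete _) (isOpen_discrete _)
  haveI := hNn
  -- Chebotarev at the class of `σ`
  obtain ⟨q, hqS, -, 𝔓, h𝔓, Fr, hFr, hFrσ⟩ :=
    exists_isArithFrobAt_mul_inv_mem_not_mem ℚ N hNo (a * τ) S hS
  -- transport along the coset `Fr = ν σ`, `ν ∈ N`
  have hνG : Fr * (a * τ)⁻¹ ∈ G := hNK hFrσ
  have hFrν : Fr = Fr * (a * τ)⁻¹ * (a * τ) := by rw [inv_mul_cancel_right]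
  have hρFr : galoisRepTorsion W 2 Fr = galoisRepTorsion W 2 τ := by
    rw [hFrν, map_mul, MonoidHom.mem_ker.mp (Subgroup.mem_inf.mp hνG).1, one_mul, hρσ]
  have hφFr : φ₀.1 Fr = φ₀.1 (a * τ) := by
    rw [hFrν, contOneCocycles.apply_mul_of_fixed φ₀ (hGV _ hνG) (a * τ), hNφ _ hFrσ, zero_add]
  have hψFr : ψ₀.1 Fr = ψ₀.1 (a * τ) := by
    rw [hFrν, contOneCocycles.apply_mul_of_fixed ψ₀ (hGV _ hνG) (a * τ), hNψ _ hFrσ, zero_add]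
  have hFrx : ∀ x : geomTorsion W (2 : ℤ), Fr • x = τ • x := fun x => by
    rw [hFrν, mul_smul, hσx]
    exact (mem_ker_galoisRepTorsion_two_iff W _).mp (Subgroup.mem_inf.mp hνG).1 (τ • x)
  have hτ1 : galoisRepTorsion W 2 (τ * τ) = 1 :=
    MonoidHom.mem_ker.mp ((mem_ker_galoisRepTorsion_two_iff W (τ * τ)).mpr hττ)
  refine ⟨q, hqS, 𝔓, h𝔓, Fr, hFr, ?_, ?_, ?_, ?_⟩
  · rw [hρFr]
    exact hρc
  · rw [map_mul, hρFr, ← map_mul, hτ1]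
  · rw [hFrν]
    exact (κ.layerSubgroup n).mul_mem (hNL hFrσ) hσn
  · rw [hφFr, hψFr, hFrx, hφσ, hψσ]
    exact weilPairingHom_two_smul_sub_ne_zero W eW hμ hadd₁ hadd₂ halt hnondeg hsign hz1 hz2

/-- **(H-C) on the bottom cocycles for the CYCLOTOMIC tower, either sign of `Δ`** (`ρ̄_{E,2}` onto, `2Δ ∉ ℚ^{×2}`):
the transposition `τ ∈ ker κ` is supplied by `exists_mem_kerSubgroup_sign_permGal_eq_neg_one_of_isCyclotomic`.
[cite: MazurRubin2004, §3.6 and Prop. 1.3.2] [cite: Washington1997, §13.1] -/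
theorem exists_isArithFrobAt_transposition_weilPairingHom_ne_zero_of_isCyclotomic (hκ : κ.IsCyclotomic)
    (h2 : W.HasSurjectiveModNGaloisRep 2) (hΔ : ¬ IsSquare (2 * W.Δ))
    (φ₀ ψ₀ : contOneCocycles (W.torsionGaloisModule (2 : ℤ)).toTopRep)
    (hφ₀ : ∃ ν ∈ (galoisRepTorsion W 2).ker ⊓ κ.kerSubgroup, φ₀.1 ν ≠ 0)
    (hψ₀ : ∃ ν ∈ (galoisRepTorsion W 2).ker ⊓ κ.kerSubgroup, ψ₀.1 ν ≠ 0)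
    (eW : geomTorsion W (2 : ℤ) → geomTorsion W (2 : ℤ) → AlgebraicClosure ℚ)
    (hμ : ∀ S T, eW S T ^ 2 = 1)
    (hadd₁ : ∀ S₁ S₂ T, eW (S₁ + S₂) T = eW S₁ T * eW S₂ T)
    (hadd₂ : ∀ S T₁ T₂, eW S (T₁ + T₂) = eW S T₁ * eW S T₂)
    (halt : ∀ T, eW T T = 1) (hnondeg : ∀ T, (∀ S, eW S T = 1) → T = 0)
    (S : Set (HeightOneSpectrum (𝓞 ℚ))) (hS : S.Finite) (n : ℕ) :
    ∃ q : HeightOneSpectrum (𝓞 ℚ), q ∉ S ∧ ∃ 𝔓 ∈ q.primesAbove, ∃ Fr : absoluteGaloisGroup ℚ,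
      IsArithFrobAt (𝓞 ℚ) Fr 𝔓 ∧ galoisRepTorsion W 2 Fr ≠ 1 ∧ galoisRepTorsion W 2 (Fr * Fr) = 1 ∧
      Fr ∈ κ.layerSubgroup n ∧
      weilPairingHom W 2 eW hμ hadd₁ hadd₂ (Fr • φ₀.1 Fr - φ₀.1 Fr) (ψ₀.1 Fr) ≠ 0 := by
  obtain ⟨τ, hτκ, hsign⟩ := exists_mem_kerSubgroup_sign_permGal_eq_neg_one_of_isCyclotomic W κ hκ h2 hΔ
  exact exists_isArithFrobAt_transposition_weilPairingHom_ne_zero_of_mem_kerSubgroup W κ h2 hτκ hsign φ₀ ψ₀ hφ₀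
    hψ₀ eW hμ hadd₁ hadd₂ halt hnondeg S hS n

end Main

/-! ## §3 (H-C) `ChebotarevTranspositionTwo` with `Δ < 0` replaced by `2Δ ∉ ℚ^{×2}`, resp. by good reduction at `2` -/

/-- **(H-C) for the cyclotomic tower WITHOUT the sign hypothesis**: the displayed statement
`ChebotarevTranspositionTwo` of `…OmegaRoadDefs` §2 with its binder `W.Δ < 0` REPLACED by `¬ IsSquare (2 * W.Δ)` — a
Chebotarev prime `q ∉ S` whose Frobenius is a transposition on `E[2]`, of depth `≥ n`, with non-degenerate bottom pairing
`e₂((ρ̄(Fr) − 1)·φ(Fr)₀, ψ(Fr)₀) ≠ 0`, for every globally minimal `W` with `ρ̄_{W,2}` onto, `κ` CYCLOTOMIC (the binder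
`κ.IsCyclotomic`, idle in p662346, is used here). In particular Ω1 holds on the `0 < Δ` half of B8's habitat.
[cite: MazurRubin2004, §3.6 and Prop. 1.3.2] [cite: TateGCFT1967, §2.4 (Tchebotarev density theorem) with Prop. 2.3] -/
theorem chebotarevTransposition_two_of_isCyclotomic :
    ∀ (W : WeierstrassCurve ℚ) [W.IsElliptic] [W.IsGloballyMinimal] (κ : ZpExtension ℚ 2)
      (γ : absoluteGaloisGroup ℚ),
      W.HasSurjectiveModNGaloisRep 2 → ¬ IsSquare (2 * W.Δ) → κ.IsCyclotomic → κ.IsTopGenerator γ →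
      ∀ (κ' : κ.twistTower (W.torsionGaloisModule (2 : ℤ))
          (fun P : WeierstrassCurve.geomTorsion W (2 : ℤ) => AddSubgroup.torsionBy.nsmul P)),
        κ.towerConst (W.torsionGaloisModule (2 : ℤ)) (fun P => AddSubgroup.torsionBy.nsmul P) κ' ≠ 0 →
      ∀ (J : ℕ) (φ : contOneCocycles (W.modPTwist 2 κ (J + 1)).toTopRep),
        oneCocycleClass (W.modPTwist 2 κ (J + 1)).toTopRep φ = κ'.1 (J + 1) →
      ∀ (ψ : contOneCocycles (W.modPTwist 2 κ.invTwist (J + 1)).toTopRep),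
        (κ.invTwist.shiftH1 (W.torsionGaloisModule (2 : ℤ))
            (fun P : WeierstrassCurve.geomTorsion W (2 : ℤ) => AddSubgroup.torsionBy.nsmul P) (J + 1))^[J]
          (oneCocycleClass (W.modPTwist 2 κ.invTwist (J + 1)).toTopRep ψ) ≠ 0 →
      ∀ (eW : WeierstrassCurve.geomTorsion W (2 : ℤ) → WeierstrassCurve.geomTorsion W (2 : ℤ) →
          AlgebraicClosure ℚ)
        (hμ : ∀ S T, eW S T ^ 2 = 1)
        (hadd₁ : ∀ S₁' S₂' T, eW (S₁' + S₂') T = eW S₁' T * eW S₂' T)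
        (hadd₂ : ∀ S T₁ T₂, eW S (T₁ + T₂) = eW S T₁ * eW S T₂),
        (∀ T, eW T T = 1) → (∀ T, (∀ S, eW S T = 1) → T = 0) →
        (∀ (σ : absoluteGaloisGroup ℚ) (S T : WeierstrassCurve.geomTorsion W (2 : ℤ)),
          σ • eW S T = eW (σ • S) (σ • T)) →
      ∀ (S : Set (HeightOneSpectrum (𝓞 ℚ))), S.Finite → ∀ (n : ℕ),
      ∃ q : HeightOneSpectrum (𝓞 ℚ), q ∉ S ∧ ∃ 𝔓 ∈ q.primesAbove, ∃ Fr : absoluteGaloisGroup ℚ,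
        IsArithFrobAt (𝓞 ℚ) Fr 𝔓 ∧
        WeierstrassCurve.galoisRepTorsion W 2 Fr ≠ 1 ∧ WeierstrassCurve.galoisRepTorsion W 2 (Fr * Fr) = 1 ∧
        Fr ∈ κ.layerSubgroup n ∧
        weilPairingHom W 2 eW hμ hadd₁ hadd₂ (Fr • φ.1 Fr ⟨0, Nat.succ_pos J⟩ - φ.1 Fr ⟨0, Nat.succ_pos J⟩)
          (ψ.1 Fr ⟨0, Nat.succ_pos J⟩) ≠ 0 := by
  intro W _ _ κ _ h2 hΔ hκ _ κ' hκ' J φ hφ ψ hψ eW hμ hadd₁ hadd₂ halt hnondeg _ S hS n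
  obtain ⟨q, hq, 𝔓, h𝔓, Fr, hFr, hρ1, hρ2, hFrn, hne⟩ :=
    exists_isArithFrobAt_transposition_weilPairingHom_ne_zero_of_isCyclotomic W κ hκ h2 hΔ _ _
      (exists_mem_constCoeff_apply_ne_zero_of_towerConst_ne_zero_of_isCyclotomic W κ hκ h2 hΔ κ' hκ' J φ hφ)
      (exists_mem_constCoeff_apply_ne_zero_of_shiftH1_iterate_ne_zero_of_isCyclotomic W κ hκ h2 hΔ J ψ hψ)
      eW hμ hadd₁ hadd₂ halt hnondeg S hS n
  exact ⟨q, hq, 𝔓, h𝔓, Fr, hFr, hρ1, hρ2, hFrn, hne⟩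

/-- **(H-C) for the cyclotomic tower at a prime of GOOD reduction `2`, either sign of `Δ`**: the statement
`ChebotarevTranspositionTwo` with `W.Δ < 0` REPLACED by `W.HasGoodReductionAtPrime 2` (`Δ_min` odd ⇒ `2Δ ∉ ℚ^{×2}`,
tree `not_isSquare_two_mul_Δ_of_good_two`) — the habitat of the crux `OrdKatoHalfAtTwoIso` and of B8.
[cite: MazurRubin2004, §3.6 and Prop. 1.3.2] [cite: DokchitserDokchitserMathZ2012, Theorem (3)] -/
theorem chebotarevTransposition_two_of_good_two :
    ∀ (W : WeierstrassCurve ℚ) [W.IsElliptic] [W.IsGloballyMinimal] (κ : ZpExtension ℚ 2)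
      (γ : absoluteGaloisGroup ℚ),
      W.HasSurjectiveModNGaloisRep 2 → W.HasGoodReductionAtPrime 2 → κ.IsCyclotomic → κ.IsTopGenerator γ →
      ∀ (κ' : κ.twistTower (W.torsionGaloisModule (2 : ℤ))
          (fun P : WeierstrassCurve.geomTorsion W (2 : ℤ) => AddSubgroup.torsionBy.nsmul P)),
        κ.towerConst (W.torsionGaloisModule (2 : ℤ)) (fun P => AddSubgroup.torsionBy.nsmul P) κ' ≠ 0 →
      ∀ (J : ℕ) (φ : contOneCocycles (W.modPTwist 2 κ (J + 1)).toTopRep),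
        oneCocycleClass (W.modPTwist 2 κ (J + 1)).toTopRep φ = κ'.1 (J + 1) →
      ∀ (ψ : contOneCocycles (W.modPTwist 2 κ.invTwist (J + 1)).toTopRep),
        (κ.invTwist.shiftH1 (W.torsionGaloisModule (2 : ℤ))
            (fun P : WeierstrassCurve.geomTorsion W (2 : ℤ) => AddSubgroup.torsionBy.nsmul P) (J + 1))^[J]
          (oneCocycleClass (W.modPTwist 2 κ.invTwist (J + 1)).toTopRep ψ) ≠ 0 →
      ∀ (eW : WeierstrassCurve.geomTorsion W (2 : ℤ) → WeierstrassCurve.geomTorsion W (2 : ℤ) →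
          AlgebraicClosure ℚ)
        (hμ : ∀ S T, eW S T ^ 2 = 1)
        (hadd₁ : ∀ S₁' S₂' T, eW (S₁' + S₂') T = eW S₁' T * eW S₂' T)
        (hadd₂ : ∀ S T₁ T₂, eW S (T₁ + T₂) = eW S T₁ * eW S T₂),
        (∀ T, eW T T = 1) → (∀ T, (∀ S, eW S T = 1) → T = 0) →
        (∀ (σ : absoluteGaloisGroup ℚ) (S T : WeierstrassCurve.geomTorsion W (2 : ℤ)),
          σ • eW S T = eW (σ • S) (σ • T)) →
      ∀ (S : Set (HeightOneSpectrum (𝓞 ℚ))), S.Finite → ∀ (n : ℕ),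
      ∃ q : HeightOneSpectrum (𝓞 ℚ), q ∉ S ∧ ∃ 𝔓 ∈ q.primesAbove, ∃ Fr : absoluteGaloisGroup ℚ,
        IsArithFrobAt (𝓞 ℚ) Fr 𝔓 ∧
        WeierstrassCurve.galoisRepTorsion W 2 Fr ≠ 1 ∧ WeierstrassCurve.galoisRepTorsion W 2 (Fr * Fr) = 1 ∧
        Fr ∈ κ.layerSubgroup n ∧
        weilPairingHom W 2 eW hμ hadd₁ hadd₂ (Fr • φ.1 Fr ⟨0, Nat.succ_pos J⟩ - φ.1 Fr ⟨0, Nat.succ_pos J⟩)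
          (ψ.1 Fr ⟨0, Nat.succ_pos J⟩) ≠ 0 := by
  intro W _ _ κ γ h2 hgood hκ hγ
  exact chebotarevTransposition_two_of_isCyclotomic W κ γ h2 (not_isSquare_two_mul_Δ_of_good_two W hgood).1 hκ hγ

end Summit.BirchSwinnertonDyer.BirchSwinnertonDyer.Theorems.SteinbergFibreAtTwo

end
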